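import Summits.FinalStateConjecture.FinalStateConjecture.Theses.LeakageWritesInInk

/-!
# Route LeakageWritesInInk — the glue `InkChain`

Support item `stmt-FinalStateConjecture-10228` of route `LeakageWritesInInk` for the Final State
Conjecture: the propositional chain

`LeakageTimeAnalyticity → TimeAnalyticLiouville → EternalExteriorStationary`.

All three route decls quantify over the same data `(a r₀ : ℝ)` and metric components `G`, under the
byte-identical seven-clause hypothesis bundle `h` of the shared target `EternalExteriorStationary`
(dark eternal harmonic-gauge vacuum exterior on `Kerr.region a r₀`). `LeakageTimeAnalyticity`
produces from `h` the uniform-strip time-analyticity clause, and `TimeAnalyticLiouville` consumes `h`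
together with exactly that clause to give `t`-independence of `G`, which is the conclusion of
`EternalExteriorStationary`. Hence the chain is pure composition — the same term the route's deciding
theorem `closes` uses (`fun a r₀ G h ↦ hS a r₀ G h (hA a r₀ G h)`). No analysis happens here.
-/

-- every `Summit.FinalStateConjecture.FinalStateConjecture.…` name repeats the summit = sub-problem
-- segment (D-0017 layout, CONVENTIONS §2; lakefile sets it for the library build, a standalone
-- elaboration of this file does not see that option); the duplicate is deliberate.
set_option linter.dupNamespace false

namespace Summit.FinalStateConjecture.FinalStateConjecture.Theorems

open Summit.FinalStateConjecture.FinalStateConjecture.Theses.LeakageWritesInInk in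
/-- **InkChain** (item `stmt-FinalStateConjecture-10228`, route `LeakageWritesInInk`):
`LeakageTimeAnalyticity → TimeAnalyticLiouville → EternalExteriorStationary`.
Given the hypothesis bundle `h` of the target for `(a, r₀, G)`, the first crux `hA` yields the
uniform-strip time-analyticity of `G`, and the second crux `hS` turns `h` plus that strip into
`G (x + s • e₀) = G x` on the whole region — the conclusion of `EternalExteriorStationary`. -/
theorem inkChain_proof :
    Summit.FinalStateConjecture.FinalStateConjecture.Theses.LeakageWritesInInk.InkChain := by
  unfold InkChain
  intro hA hS a r₀ G h
  exact hS a r₀ G h (hA a r₀ G h)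

end Summit.FinalStateConjecture.FinalStateConjecture.Theorems
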